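import Literature.AnabelianGeometry.SemiGraphs.TemperedFreeTwoSlim
import Literature.AnabelianGeometry.SemiGraphs.CoverticialCoveringGroupLemmas
import Literature.AnabelianGeometry.Anabelioids.Basic
import HarnessLib

/-!
# The procyclic subgroup `cl η⟨a⟩ ≅ Ẑ` of `F̂₂` is commensurably terminal ([SemiAnbd] §0 p. 5, Thm. 6.5 (ii))

Mochizuki, *Semi-graphs of anabelioids*, Publ. RIMS **42** (2006) [SemiAnbd], §0 p. 5 ("commensurably
terminal": `C_G(H) = H`, `C_G(H) = {g | H ∩ gHg⁻¹ has finite index in both}`) and Theorem 6.5 (ii)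
p. 71 ("The subgroup `D_x` is commensurably terminal in `Π^temp_{X_K}`. If `x` is a cusp, then
`D_x = C_{Π^temp_{X_K}}(H)` for any open subgroup `H ⊆ I_x`"). [cite: MochizukiSemiAnbd2006, Thm 6.5(ii) p.71]

PROOF-ONLY group theory (abc-iut cell, prover abc-iut-w5-d040; input of the Thm. 6.5 non-vacuity
witness `TemperedCurveThm65NonVacuity.lean`; no definition).  In the style and with the notation of
abc-iut-w5-d218's `TemperedFreeTwoSlim.lean`: `F̂₂` is the profinite completion of the free group on
`a = of 0`, `b = of 1`, `η : F₂ → F̂₂`, `Ẑ` the profinite completion of `ℤ` with `ι : ℤ → Ẑ`; the data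
`ê_a : F̂₂ → Ẑ` (completing the exponent sum `σ_a`, `σ_a(a) = 1`) and `îa : Ẑ → F̂₂` (completing
`k ↦ a^k`) are HYPOTHESES of the shape the witness files instantiate with Mathlib's
`ProfiniteCompletion.lift`.  We prove, for `A := îa(Ẑ) = cl η⟨a⟩`:

* `zhat_mul_comm` — `Ẑ` is commutative (density of `ℤ`);
* `mem_range_of_conj_pow_mem` — **if `g⁻¹ η(a^n) g ∈ A` for some `n ≠ 0` then `g ∈ A`**: evaluating
  `ê_a` (a homomorphism to the commutative `Ẑ` with `ê_a ∘ îa = id`) shows `g⁻¹ η(a^n) g = η(a^n)`, and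
  the centraliser condition `C_{F̂₂}(η(a^n)) ⊆ cl η⟨a⟩ = îa(Ẑ)` (abc-iut-L5-d2 / Magnus–Karrass–Solitar
  4.1.6, packaged as `TemperedFibreProduct.centralizer_eta_of_zpow_subset`) concludes;
* `commensurator_range_eq` — **`C_{F̂₂}(A) = A`** (`A` is commensurably terminal): a commensurating `g`
  has `(gAg⁻¹ ∩ A)` of finite index in `A`, hence containing some `η(a)^n`, `n > 0`
  (`Subgroup.exists_pow_mem_of_relIndex_ne_zero`), and the previous lemma applies to `g⁻¹`… ;
* `commensurator_comap_snd_eq` — in any product `G × F̂₂`, **`C(G × A) = G × A`**, and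
  `commensurator_eq_of_le_one_prod` — **`C(H) = G × A` for every `H ≤ 1 × A` containing some
  `(1, η(a^n))`, `n > 0`** (the shape "`D_x = C(H)` for open `H ⊆ I_x`").

Classical profinite group theory; nothing of [SemiAnbd] is asserted; no side is taken on [IUTchIII]
Cor. 3.12.
-/

noncomputable section

open Topology Filter Set Function
open scoped Pointwise
open Literature.IUT.HodgeTheaters (profiniteCompletion toCompletion)
open Literature.AnabelianGeometry.Anabelioids (le_commensurator)

namespace Literature.AnabelianGeometry.SemiGraphs

namespace FreeTwoProcyclic

/-- `Ẑ` (the profinite completion of `ℤ`, [SemiAnbd] p. 71 "`Ẑ(1)` [i.e., the profinite completion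
of `ℤ` …]") is commutative: the commutator relation is closed and holds on the dense image of `ℤ`.
[cite: MochizukiSemiAnbd2006, §6 p.71] -/
theorem zhat_mul_comm (x y : profiniteCompletion (Multiplicative ℤ)) : x * y = y * x := by
  have hd : DenseRange (toCompletion (Multiplicative ℤ)) :=
    ProfiniteGrp.ProfiniteCompletion.denseRange (GrpCat.of (Multiplicative ℤ))
  have hcl : IsClosed {q : profiniteCompletion (Multiplicative ℤ) × profiniteCompletion (Multiplicative ℤ) |
      q.1 * q.2 = q.2 * q.1} :=
    isClosed_eq (continuous_fst.mul continuous_snd) (continuous_snd.mul continuous_fst)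
  have hmem : (x, y) ∈ {q : profiniteCompletion (Multiplicative ℤ) × profiniteCompletion (Multiplicative ℤ) |
      q.1 * q.2 = q.2 * q.1} := by
    refine (hd.prodMap hd).induction_on (p := fun q => q ∈ {q : _ × _ | q.1 * q.2 = q.2 * q.1})
      (x, y) hcl ?_
    rintro ⟨m, n⟩
    change toCompletion _ m * toCompletion _ n = toCompletion _ n * toCompletion _ m
    rw [← map_mul, ← map_mul, mul_comm]
  exact hmem

variable (e : profiniteCompletion (FreeGroup (Fin 2)) →ₜ* profiniteCompletion (Multiplicative ℤ))
  (îa : profiniteCompletion (Multiplicative ℤ) →ₜ* profiniteCompletion (FreeGroup (Fin 2)))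
  (σa : FreeGroup (Fin 2) →* Multiplicative ℤ)
  (hσaa : σa (FreeGroup.of 0) = Multiplicative.ofAdd 1)
  (he : ∀ g, e (toCompletion _ g) = toCompletion _ (σa g))
  (hîa : ∀ k : ℤ, îa (toCompletion _ (Multiplicative.ofAdd k)) = toCompletion _ (FreeGroup.of 0 ^ k))

include hσaa he hîa in
/-- **Core**: if `g⁻¹ η(a^n) g ∈ îa(Ẑ)` for some `n ≠ 0`, then `g ∈ îa(Ẑ)`.  Evaluate `ê_a`: since `Ẑ` is
commutative and `ê_a ∘ îa = id`, the element `t` with `îa t = g⁻¹ η(a^n) g` is `ι(n)`, so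
`g⁻¹ η(a^n) g = η(a^n)`, i.e. `g⁻¹ ∈ C(η(a^n)) ⊆ cl η⟨a⟩ = îa(Ẑ)`. [cite: MochizukiSemiAnbd2006, Thm 6.5(ii) p.71] -/
theorem mem_range_of_conj_pow_mem {g : profiniteCompletion (FreeGroup (Fin 2))} {n : ℤ} (hn : n ≠ 0)
    (h : g⁻¹ * toCompletion _ (FreeGroup.of 0 ^ n) * g ∈ îa.toMonoidHom.range) :
    g ∈ îa.toMonoidHom.range := by
  set η := toCompletion (FreeGroup (Fin 2)) with hη
  set ι := toCompletion (Multiplicative ℤ) with hι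
  set a : FreeGroup (Fin 2) := FreeGroup.of 0 with ha
  obtain ⟨t, ht⟩ := h
  -- evaluate `e`
  have heîa : ∀ s, e (îa s) = s := TemperedFibreProduct.apply_apply_eq_self_of a σa hσaa e îa he hîa
  have hean : e (η (a ^ n)) = ι (Multiplicative.ofAdd n) := by
    rw [he, map_zpow, hσaa, ← ofAdd_zsmul, smul_eq_mul, mul_one]
  have ht2 : îa t = g⁻¹ * η (a ^ n) * g := ht
  have ht' : t = ι (Multiplicative.ofAdd n) := by
    have h1 : e (îa t) = t := heîa t
    rw [ht2, map_mul, map_mul, map_inv, hean] at h1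
    calc t = (e g)⁻¹ * ι (Multiplicative.ofAdd n) * e g := h1.symm
      _ = ι (Multiplicative.ofAdd n) * (e g)⁻¹ * e g := by rw [zhat_mul_comm ((e g)⁻¹)]
      _ = ι (Multiplicative.ofAdd n) := by rw [mul_assoc, inv_mul_cancel, mul_one]
  -- hence `g⁻¹ η(a^n) g = η(a^n)`
  have hconj : g⁻¹ * η (a ^ n) * g = η (a ^ n) := by
    rw [← ht2, ht', hîa]
  -- so `g⁻¹` centralises `η(a^n)`, hence lies in `cl η⟨a⟩ ⊆ range îa`
  have hcomm : g⁻¹ * η (a ^ n) = η (a ^ n) * g⁻¹ := by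
    calc g⁻¹ * η (a ^ n) = g⁻¹ * η (a ^ n) * g * g⁻¹ := by rw [mul_assoc (g⁻¹ * η (a ^ n)), mul_inv_cancel, mul_one]
      _ = η (a ^ n) * g⁻¹ := by rw [hconj]
  have hz' : g⁻¹ ∈ Subgroup.centralizer ({η (a ^ n)} : Set (profiniteCompletion (FreeGroup (Fin 2)))) :=
    Subgroup.mem_centralizer_singleton_iff.mpr hcomm
  obtain ⟨u, hu⟩ := TemperedFibreProduct.closure_eta_zpowers_subset_range a îa hîa
    (TemperedFibreProduct.centralizer_eta_of_zpow_subset 0 hn hz')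
  have : g⁻¹ ∈ îa.toMonoidHom.range := ⟨u, hu⟩
  simpa using îa.toMonoidHom.range.inv_mem this

include hîa in
/-- `η(a)` lies in `îa(Ẑ)` (`îa(ι 1) = η(a)`). [cite: MochizukiSemiAnbd2006, Thm 6.5(ii) p.71] -/
theorem eta_of_zero_mem_range : toCompletion _ (FreeGroup.of (0 : Fin 2)) ∈ îa.toMonoidHom.range :=
  ⟨toCompletion _ (Multiplicative.ofAdd (1 : ℤ)), by
    change îa _ = _
    rw [hîa, zpow_one]⟩

include hσaa he hîa in
/-- **`îa(Ẑ) = cl η⟨a⟩` is commensurably terminal in `F̂₂`**: `C_{F̂₂}(îa(Ẑ)) = îa(Ẑ)`.  If `g`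
commensurates `A = îa(Ẑ)`, then `gAg⁻¹ ∩ A` has finite index in `A`, so it contains `η(a)^n` for some
`n > 0`; thus `g⁻¹ η(a^n) g ∈ A` and `mem_range_of_conj_pow_mem` gives `g ∈ A`.
[cite: MochizukiSemiAnbd2006, Thm 6.5(ii) p.71] -/
theorem commensurator_range_eq :
    Subgroup.Commensurable.commensurator îa.toMonoidHom.range = îa.toMonoidHom.range := by
  refine le_antisymm (fun g hg => ?_) (le_commensurator _)
  rw [Subgroup.Commensurable.commensurator_mem_iff] at hg
  obtain ⟨n, hn0, -, hn⟩ := Subgroup.exists_pow_mem_of_relIndex_ne_zero hg.1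
    (eta_of_zero_mem_range îa hîa)
  have hmem : (toCompletion _ (FreeGroup.of (0 : Fin 2))) ^ n ∈
      ConjAct.toConjAct g • îa.toMonoidHom.range := (Subgroup.mem_inf.mp hn).1
  rw [mem_conjAct_smul_iff, ← map_pow, ← zpow_natCast] at hmem
  exact mem_range_of_conj_pow_mem e îa σa hσaa he hîa (by exact_mod_cast hn0.ne') hmem

/-! ### In a product `G × F̂₂` -/

variable {G : Type*} [Group G]

include hσaa he hîa in
/-- **`C_{G × F̂₂}(H) ⊆ G × îa(Ẑ)` for every `H ≤ G × F̂₂` contained in `G × îa(Ẑ)` and containing some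
`(1, η(a)^n)`, `n > 0`**: a commensurating `c = (c₁, c₂)` has `cHc⁻¹ ∩ H` of finite index in `H`, hence
containing a power `(1, η(a)^{nm})`, so `c₂⁻¹ η(a^{nm}) c₂ ∈ îa(Ẑ)` and `c₂ ∈ îa(Ẑ)`.
[cite: MochizukiSemiAnbd2006, Thm 6.5(ii) p.71] -/
theorem commensurator_le_comap_snd (H : Subgroup (G × profiniteCompletion (FreeGroup (Fin 2))))
    (hH : H ≤ îa.toMonoidHom.range.comap (MonoidHom.snd G _)) {n : ℕ} (hn : 0 < n)
    (hmem : ((1 : G), toCompletion _ (FreeGroup.of (0 : Fin 2)) ^ n) ∈ H) :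
    Subgroup.Commensurable.commensurator H ≤ îa.toMonoidHom.range.comap (MonoidHom.snd G _) := by
  intro c hc
  rw [Subgroup.Commensurable.commensurator_mem_iff] at hc
  obtain ⟨m, hm0, -, hm⟩ := Subgroup.exists_pow_mem_of_relIndex_ne_zero hc.1 hmem
  have h1 : (((1 : G), toCompletion _ (FreeGroup.of (0 : Fin 2)) ^ n) ^ m :
      G × profiniteCompletion (FreeGroup (Fin 2))) ∈ ConjAct.toConjAct c • H := (Subgroup.mem_inf.mp hm).1
  rw [mem_conjAct_smul_iff] at h1
  have h2 := hH h1
  rw [Subgroup.mem_comap] at h2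
  have h3 : c.2⁻¹ * toCompletion _ (FreeGroup.of (0 : Fin 2) ^ ((n * m : ℕ) : ℤ)) * c.2 ∈
      îa.toMonoidHom.range := by
    rw [zpow_natCast, map_pow, pow_mul]
    simpa using h2
  have hnm : ((n * m : ℕ) : ℤ) ≠ 0 := by exact_mod_cast (Nat.mul_pos hn hm0).ne'
  exact mem_range_of_conj_pow_mem e îa σa hσaa he hîa hnm h3

/-- Elements of `îa(Ẑ) ≅ Ẑ(1)` commute (image of the commutative `Ẑ`; [SemiAnbd] p. 71 "`I_x` is
isomorphic to `Ẑ(1)`"). [cite: MochizukiSemiAnbd2006, §6 p.71] -/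
theorem range_comm {x y : profiniteCompletion (FreeGroup (Fin 2))} (hx : x ∈ îa.toMonoidHom.range)
    (hy : y ∈ îa.toMonoidHom.range) : x * y = y * x := by
  obtain ⟨s, rfl⟩ := hx
  obtain ⟨t, rfl⟩ := hy
  change îa s * îa t = îa t * îa s
  rw [← map_mul, ← map_mul, zhat_mul_comm]

/-- Conjugation by an element of `G × îa(Ẑ)` fixes every subgroup `H ≤ 1 × îa(Ẑ)` (the second
components commute). [cite: MochizukiSemiAnbd2006, Thm 6.5(ii) p.71] -/
theorem conjAct_smul_eq_self_of_le (H : Subgroup (G × profiniteCompletion (FreeGroup (Fin 2))))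
    (hH : ∀ x ∈ H, x.1 = 1 ∧ x.2 ∈ îa.toMonoidHom.range)
    {c : G × profiniteCompletion (FreeGroup (Fin 2))} (hc : c.2 ∈ îa.toMonoidHom.range) :
    ConjAct.toConjAct c • H = H := by
  -- conjugation by `c` and by `c⁻¹` fix `H` pointwise
  have key : ∀ x ∈ H, c⁻¹ * x * c = x := by
    intro x hx
    obtain ⟨hx1, hx2⟩ := hH x hx
    refine Prod.ext ?_ ?_
    · simp [hx1]
    · change c.2⁻¹ * x.2 * c.2 = x.2
      rw [mul_assoc, range_comm îa hx2 hc, ← mul_assoc, inv_mul_cancel, one_mul]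
  have key' : ∀ y ∈ H, c * y * c⁻¹ = y := by
    intro y hy
    obtain ⟨hy1, hy2⟩ := hH y hy
    refine Prod.ext ?_ ?_
    · simp [hy1]
    · change c.2 * y.2 * c.2⁻¹ = y.2
      rw [range_comm îa hc hy2, mul_assoc, mul_inv_cancel, mul_one]
  ext x
  rw [mem_conjAct_smul_iff]
  constructor
  · intro hx
    have h1 : x = c * (c⁻¹ * x * c) * c⁻¹ := by group
    rw [h1, key' _ hx]
    exact hx
  · intro hx
    rw [key x hx]; exact hx

include hσaa he hîa in
/-- **`C_{G × F̂₂}(H) = G × îa(Ẑ)` for every `H ≤ 1 × îa(Ẑ)` containing some `(1, η(a)^n)`, `n > 0`** —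
the shape of [SemiAnbd] Thm. 6.5 (ii) "`D_x = C(H)` for any open subgroup `H ⊆ I_x`" at the model
`D_x = G × îa(Ẑ)`, `I_x = 1 × îa(Ẑ)`. [cite: MochizukiSemiAnbd2006, Thm 6.5(ii) p.71] -/
theorem commensurator_eq_of_le_one_prod (H : Subgroup (G × profiniteCompletion (FreeGroup (Fin 2))))
    (hH : ∀ x ∈ H, x.1 = 1 ∧ x.2 ∈ îa.toMonoidHom.range) {n : ℕ} (hn : 0 < n)
    (hmem : ((1 : G), toCompletion _ (FreeGroup.of (0 : Fin 2)) ^ n) ∈ H) :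
    Subgroup.Commensurable.commensurator H = îa.toMonoidHom.range.comap (MonoidHom.snd G _) := by
  refine le_antisymm
    (commensurator_le_comap_snd e îa σa hσaa he hîa H (fun x hx => ?_) hn hmem) (fun c hc => ?_)
  · rw [Subgroup.mem_comap]; exact (hH x hx).2
  · rw [Subgroup.mem_comap] at hc
    rw [Subgroup.Commensurable.commensurator_mem_iff, conjAct_smul_eq_self_of_le îa H hH hc]

include hσaa he hîa in
/-- **`C_{G × F̂₂}(G × îa(Ẑ)) = G × îa(Ẑ)`** — the shape of [SemiAnbd] Thm. 6.5 (ii) "`D_x` is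
commensurably terminal" at the model `D_x = G × îa(Ẑ)`. [cite: MochizukiSemiAnbd2006, Thm 6.5(ii) p.71] -/
theorem commensurator_comap_snd_eq :
    Subgroup.Commensurable.commensurator (îa.toMonoidHom.range.comap (MonoidHom.snd G _)) =
      îa.toMonoidHom.range.comap (MonoidHom.snd G _) := by
  refine le_antisymm ?_ (le_commensurator _)
  refine commensurator_le_comap_snd e îa σa hσaa he hîa _ le_rfl Nat.one_pos ?_
  rw [Subgroup.mem_comap, pow_one]
  exact eta_of_zero_mem_range îa hîa

end FreeTwoProcyclic

end Literature.AnabelianGeometry.SemiGraphs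

end
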